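import Summits.Ventures.QEC.Census.CertCheck
import HarnessLib

/-!
# Distance certificate DATA for the census row `S8_30_w8_k10_03919B0` (family GB) as `S8_30_w8_k10_03919B0.cert` — emitted by qec-type-07 (07.MITMK)

Source certificate: `cert/search-8/2bga-g30-A0.3.9.19-B0.5.12.18.certA.json` — kernel A, id (sha256) `5dd95704e96526e2c4cfadc3fce7f9a3c6e279f4508684ba935aac853f5c3531` (`certA=5dd95704e96526e2`),
lower-bound methods bz (Z) / bz (X) as RUN BY KERNEL A; here only its matrices,
upper witnesses and allow-lists are data — the lower bound is RE-ESTABLISHED in the kernel by the meet-in-the-middle lane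
`Census/CertMitmK.lean` (sibling files `MitmKZ*.lean` — Z side; the X side by the kernel X↔Z swap of `Census/CertCheckXZSwap.lean`), the row theorem is `GB/S8_30_w8_k10_03919B0/Distance.lean`.
Code: n = 60, 30 X-checks, 30 Z-checks; construction {"type": "explicit"}; generators
`/work/gens/s8/2bga-g30-A0.3.9.19-B0.5.12.18.json` (matrix_sha256 `c1fe45eb54109148612c64b9d2dcb3ca0bc152fed6a523b6cce7bd8686dbbc1e`); claimed (n, k, dZ, dX) =
(60, 10, 8, 8) — a CLAIM of the certificate until the sibling theorems;
printed/third-party value: none — a census-discovered code (no parameters for it are claimed in print; any TABLE `d_printed` entry is a census/third-method comparator, wording qec-lead's).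
Allow-lists (`found`): side Z: the certificate's 0 words verbatim; side X: the certificate's list verbatim (not used: the X side follows by the kernel X↔Z swap, `Distance.lean`).
Format = qec-search-7's `emit_lean.py` (`Census/<F>/<Code>/Cert.lean` convention: supports as binary numerals, bit `j` =
qubit `j` of the gens file, identity layout). This file is DATA: no theorem, no `decide`. Generated 2026-08-27T12:36Z by
HOME/census/type-07/emit_mitmk.py; do not edit by hand — re-emit.
-/

namespace Summit.Ventures.QEC.Census.S8_30_w8_k10_03919B0

/-- The distance certificate of `S8_30_w8_k10_03919B0` as a `DistCert` literal (CERT-FORMAT v1 kernel fields; certificate id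
`5dd95704e96526e2`): `n = 60`, `HX`/`HZ` = the 30 + 30 check rows (words as binary numerals (bit `j` = qubit `j`)), side Z =
(d := 8, weight-8 Z-logical witness, its non-membership witness, allow-list of 0 stabilizer words with
their row decompositions), side X likewise (d := 8, 0 words). -/
def cert : DistCert where
  n := 60
  HX := [
    285908457226761, 571816914453522, 1143633828907044, 2287267657814088, 4574535315628176, 9149070631256352,
    18298141262512704, 36596282525025408, 73192565050050816, 146385130100101632, 292770260200203264, 585540519326664705,
    18159535120224258, 36319070240448516, 72638140480897032, 145276280961794064, 290552561923588128, 581105123847176256,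
    9288744161247360, 18577488322494720, 37154976644989440, 74309952216237057, 148619904432474114, 297239808864948228,
    594479617729896456, 36037731926687760, 72075463853375520, 144150926633009217, 288301853266018434, 576603706532036868]
  HZ := [
    146369188020359169, 292738376040718338, 585476752081436676, 18032000629768200, 36064001259536400, 72128001445330977,
    144256002890661954, 288512005781323908, 577024011562647816, 1126519592190480, 2253039184380960, 4506078368761920,
    9012155663782017, 18024311327564034, 36048622655128068, 72097245310256136, 144194490620512272, 288388981241024544,
    576777961408307265, 634419283509378, 1268838567018756, 2537677134037512, 5075354268075024, 10150708536150048,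
    20301417072300096, 40602834144600192, 81205668289200384, 162411336578400768, 324822673156801536, 649645346313603072]
  sideZ := { d := 8, witness := 576461078729328680, nonmember := 2996686704,
             found := [] }
  sideX := { d := 8, witness := 297818126135853318, nonmember := 43746615,
             found := [] }

end Summit.Ventures.QEC.Census.S8_30_w8_k10_03919B0
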